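import Summits.BirchSwinnertonDyer.BirchSwinnertonDyer.Theorems.ByReductionTypeAtTwoMultUpperHalfTowerFiltAddv3
import Summits.BirchSwinnertonDyer.BirchSwinnertonDyer.Theorems.ByReductionTypeAtTwoTowerLocalAddvZ
import HarnessLib

/-!
# Route `ByReductionTypeAtTwo`, crux `MultUpperHalfAtTwo` (item stmt-BirchSwinnertonDyer-19922): the FILTRATION-gap doors (σ-lever) with an
# EIGHTH per-prime disjunct «ADDITIVE with NO `ℚ_ℓ`-rational `2`-torsion ⟹ ZERO bits» (seat bsd-2adic-tower-1 GEN 12)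

HONEST FRAMING (cell `bsd-2adic`, run/shared/lean/pub/bsd-2adic/, HUMAN RULINGS D-0036 / D-0054 / D-0074): research route;
THEOREMS ONLY (no definition, no new named fact); nothing is booked; BSD is not proved by any of this. PARTITION: X5@2 mult (K4ᵐ,
RESIDUAL-MAP B1·O1; the 402 `E[2]`-irreducible rank-0 classes with no class file after mult-2 GEN 10) × p = 2 — types-the-object-of (a
sharper per-prime local constant of the tower certificate); closes none. bears_on: K4 (item 19922).

WHAT. `…TowerLocalAddvZ` (this seat) proves, from the Literature theorem
`Greenberg1999.finite_and_natCard_localTowerKerPrimary_le_one_of_additive_of_twoTorsion`, that at an additive `v ∤ 2` where `E(ℚ_v)` has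
NO point of order `2` the local tower kernel `𝒦_{v,n}[2^∞]` is TRIVIAL at every layer — ZERO bits; NEW at Kodaira type `I₀*` with
Tamagawa number `c_ℓ = 1`, where every door so far charged two bits per place. This file is mult-2's `…MultUpperHalfTowerFiltAddv3`
(seven disjuncts) VERBATIM with that disjunct added: §0 `TowerAddvZ.b_eq_integralModelInt` (the integer `bᵢ` of the
certificate are those of `integralModelInt W`) and the per-place dispatcher `MultTowerAddv.pTorsion_localTowerKer_le_of_numeric_addv4`
(= `…_addv3` + «additive ∧ no `ℚ_v`-rational `2`-torsion ∧ `1 ≤ C`»); §1 the doors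
`MultTowerFilt.towerGapAtTwo_of_filtration_numeric_atTwo_addv4` / `…_nat_atTwo_addv4` — in the prime-indexed form the new certificate is
«`ℓ ∣ c₄ ∧ ℓ ∣ Δ_min ∧ ∃ k, the 2-division cubic 4x³ + b₂x² + 2b₄x + b₆ of integralModelInt W has no root in ℤ/ℓᵏ` ∧ `1 ≤ C_ℓ`»
(`decide`, `k = 4` on every census class; `TowerAddvZ.noTwoTorsion_of_cubic_cert`). The `cert` form and the binder-free habitats at `v ∣ 2`
follow in `…MultUpperHalfTowerFiltKernelAddv4`.

WHAT IS DISPLAYED, NOT PROVED: PRINT `h33g`/`hM`/`hA` (tree theorems `…_holds`), the displayed bound `h2` at `v ∣ 2`, the two filtered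
counts `hlow`/`hup` (kit certificates). ∀-LEVEL CONTENT: none.

References: R. Greenberg, LNM 1716 (1999), §3 pp. 85–94; L. Washington, *Introduction to Cyclotomic Fields*, §13; J. H. Silverman,
AEC III.§2 Ex. 3.7, VII.1, VII.5; ATAEC IV.9 Table 4.1.
-/

set_option autoImplicit false
-- the Theorems namespace of this sub repeats the summit name by design (D-0017 nested layout: Summit.<S>.<Sub>)
set_option linter.dupNamespace false

noncomputable section

open scoped Classical MatrixGroups ModularForm

open NumberField IsDedekindDomain CongruenceSubgroup WeierstrassCurve Literature.NumberTheory.EllipticCurves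
  Literature.NumberTheory.EllipticCurves.ModularForms
  Literature.NumberTheory.EllipticCurves.Greenberg1999
  Literature.NumberTheory.EllipticCurves.Rank1Residual
  Literature.NumberTheory.EllipticCurves.Rank1Residual.Typed
  Literature.NumberTheory.GaloisRepresentations
  Summit.BirchSwinnertonDyer.Rank1Residual.X5 Summit.BirchSwinnertonDyer.Rank1Residual.X5.O1
  Summit.BirchSwinnertonDyer.Rank1Residual
  Summit.BirchSwinnertonDyer.BirchSwinnertonDyer.Theorems.KatoHalfPinch
  Summit.BirchSwinnertonDyer.BirchSwinnertonDyer.Theorems.MultTowerAddv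
  Rat.HeightOneSpectrum

/-! ## §0 The integer `bᵢ` of the certificate; the per-place dispatcher with EIGHT disjuncts -/

namespace Summit.BirchSwinnertonDyer.BirchSwinnertonDyer.Theorems.TowerAddvZ

/-- The `b`-invariants of a globally minimal `W/ℚ` are those of its integral model `integralModelInt W` (`W = (integralModelInt W) ⊗ ℚ`,
tree `map_integralModelInt`; `map_b₂`, `map_b₄`, `map_b₆`). [cite: SilvermanAEC2009, III.1 (b₂, b₄, b₆) and VIII.8 (minimal models over ℤ)] -/
theorem b_eq_integralModelInt (W : WeierstrassCurve ℚ) [W.IsGloballyMinimal] :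
    W.b₂ = ((integralModelInt W).b₂ : ℚ) ∧ W.b₄ = ((integralModelInt W).b₄ : ℚ) ∧
      W.b₆ = ((integralModelInt W).b₆ : ℚ) := by
  refine ⟨?_, ?_, ?_⟩
  · conv_lhs => rw [← map_integralModelInt W]
    rw [map_b₂, eq_intCast]
  · conv_lhs => rw [← map_integralModelInt W]
    rw [map_b₄, eq_intCast]
  · conv_lhs => rw [← map_integralModelInt W]
    rw [map_b₆, eq_intCast]

/-- **The per-place INTEGER certificate in counted currency.** For a globally minimal `W/ℚ`, any `ℤ₂`-extension `κ`, the place `v` over an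
odd prime `ℓ` with `ℓ ∣ Δ_min`, `ℓ ∣ c₄` (additive) and `k` such that the `2`-division cubic of `integralModelInt W` has no root in `ℤ/ℓᵏ`:
`#𝒦_{v,n}[2^∞][2] ≤ 1` at every layer (ZERO bits at `ℓ`). [cite: GreenbergLNM1716, §3 Lemma 3.3 (proof, PDF p. 88)]
[cite: SilvermanAEC2009, VII.5 Prop. 5.1(c); III.§2 Ex. 3.7] -/
theorem pTorsion_le_one_of_intCert_noTwoTorsion (W : WeierstrassCurve ℚ) [W.IsElliptic] [W.IsGloballyMinimal]
    (κ : ZpExtension ℚ 2) (v : HeightOneSpectrum (𝓞 ℚ)) {ℓ : ℕ} [Fact ℓ.Prime] (hv : (primesEquiv v : ℕ) = ℓ) (hℓ2 : ℓ ≠ 2)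
    (hΔ : (ℓ : ℤ) ∣ W.minimalDiscriminantInt) (hc₄ : (ℓ : ℤ) ∣ (integralModelInt W).c₄) {k : ℕ}
    (hcert : ∀ x : ZMod (ℓ ^ k), 4 * x ^ 3 + ((integralModelInt W).b₂ : ZMod (ℓ ^ k)) * x ^ 2 +
      2 * ((integralModelInt W).b₄ : ZMod (ℓ ^ k)) * x + ((integralModelInt W).b₆ : ZMod (ℓ ^ k)) ≠ 0) (n : ℕ) :
    Finite {x : W.localTowerKerPrimary κ (v.adicCompletion ℚ) n // 2 • x = 0} ∧
      Nat.card {x : W.localTowerKerPrimary κ (v.adicCompletion ℚ) n // 2 • x = 0} ≤ 1 :=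
  pTorsion_le_one_of_cert_noTwoTorsion W κ v hv hℓ2 hΔ hc₄ (b_eq_integralModelInt W) hcert n

end Summit.BirchSwinnertonDyer.BirchSwinnertonDyer.Theorems.TowerAddvZ

namespace Summit.BirchSwinnertonDyer.BirchSwinnertonDyer.Theorems.MultTowerAddv

section Dispatch8

variable (W : WeierstrassCurve ℚ) [W.IsElliptic]

/-- **The local constant at an odd place — eight disjuncts.** `#𝒦_{v,n}[2] ≤ C` as soon as ONE of the seven disjuncts of
`pTorsion_localTowerKer_le_of_numeric_addv3` (mult-2 GEN 10) holds, or **`v` additive with NO `ℚ_v`-rational `2`-torsion and `1 ≤ C`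
(ZERO bits: Kodaira II/IV/IV*/II*, and I₀* with `c_v = 1`)** — `TowerAddvZ.pTorsion_le_one_of_additive_of_noTwoTorsion`.
[cite: GreenbergLNM1716, §3 Lemma 3.3 (PDF pp. 86–88)] [cite: SilvermanAEC2009, III.§2 Ex. 3.7] -/
theorem pTorsion_localTowerKer_le_of_numeric_addv4
    (h33g : lemma33_localTowerKerPrimary_eq_bot_of_good.{0})
    (hM : lemma33_localTowerKerPrimary_cyclic_of_multiplicative.{0})
    (hA : lemma33_natCard_localTowerKerPrimary_le_four_of_additive.{0})
    (κ : ZpExtension ℚ 2) (hκ : κ.IsCyclotomic) (v : HeightOneSpectrum (𝓞 ℚ))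
    (h2v : ((2 : ℕ) : 𝓞 ℚ) ∉ v.asIdeal) (n C : ℕ)
    (hC : 4 ≤ C ∨ (W.HasMultiplicativeReductionAt v ∧ 2 ≤ C) ∨
      (W.HasMultiplicativeReductionAt v ∧ ¬ 2 ∣ W.ordMinimalDiscriminant v ∧ 1 ≤ C) ∨
      (W.HasGoodReductionAt v ∧ 1 ≤ C) ∨
      (W.HasAdditiveReductionAt v ∧ ¬ 2 ∣ (W.kodairaSymbolAt v).componentGroupOrder ∧ 1 ≤ C) ∨
      (W.HasAdditiveReductionAt v ∧ (∀ m, W.kodairaSymbolAt v ≠ .Istar m) ∧ 2 ≤ C) ∨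
      (W.HasAdditiveReductionAt v ∧ ¬ 2 ∣ W.ordMinimalDiscriminant v ∧ 2 ≤ C) ∨
      (W.HasAdditiveReductionAt v ∧
        (∀ Q : localPoints W (v.adicCompletion ℚ),
          (∀ σ : Field.absoluteGaloisGroup (v.adicCompletion ℚ), σ • Q = Q) → 2 • Q = 0 → Q = 0) ∧ 1 ≤ C)) :
    Finite {x : W.localTowerKerPrimary κ (v.adicCompletion ℚ) n // 2 • x = 0} ∧
      Nat.card {x : W.localTowerKerPrimary κ (v.adicCompletion ℚ) n // 2 • x = 0} ≤ C := by
  haveI : Fact (Nat.Prime 2) := ⟨Nat.prime_two⟩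
  rcases hC with h | h | h | h | h | h | h | ⟨hadd, hQ, h1⟩
  · exact pTorsion_localTowerKer_le_of_numeric_addv3 W h33g hM hA κ hκ v h2v n C (Or.inl h)
  · exact pTorsion_localTowerKer_le_of_numeric_addv3 W h33g hM hA κ hκ v h2v n C (Or.inr (Or.inl h))
  · exact pTorsion_localTowerKer_le_of_numeric_addv3 W h33g hM hA κ hκ v h2v n C (Or.inr (Or.inr (Or.inl h)))
  · exact pTorsion_localTowerKer_le_of_numeric_addv3 W h33g hM hA κ hκ v h2v n C (Or.inr (Or.inr (Or.inr (Or.inl h))))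
  · exact pTorsion_localTowerKer_le_of_numeric_addv3 W h33g hM hA κ hκ v h2v n C
      (Or.inr (Or.inr (Or.inr (Or.inr (Or.inl h)))))
  · exact pTorsion_localTowerKer_le_of_numeric_addv3 W h33g hM hA κ hκ v h2v n C
      (Or.inr (Or.inr (Or.inr (Or.inr (Or.inr (Or.inl h))))))
  · exact pTorsion_localTowerKer_le_of_numeric_addv3 W h33g hM hA κ hκ v h2v n C
      (Or.inr (Or.inr (Or.inr (Or.inr (Or.inr (Or.inr h))))))
  · obtain ⟨hf, hle⟩ := TowerAddvZ.pTorsion_le_one_of_additive_of_noTwoTorsion W κ h2v hadd hQ n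
    exact ⟨hf, hle.trans h1⟩

end Dispatch8

end Summit.BirchSwinnertonDyer.BirchSwinnertonDyer.Theorems.MultTowerAddv

namespace Summit.BirchSwinnertonDyer.BirchSwinnertonDyer.Theorems.MultTowerFilt

/-! ## §1 The filtration gap certificate with EIGHT disjuncts (numeric and prime-indexed forms) -/

section Gap

variable (W : WeierstrassCurve ℚ) [W.IsElliptic] [W.IsGloballyMinimal]

omit [W.IsGloballyMinimal] in
/-- **The FILTRATION GAP certificate with NUMERIC local constants, the constant at `2` a DATUM, EIGHT disjuncts.** `W/ℚ` with odd
torsion order (ANY reduction type at `2`); ONE layer `n` and a window `m + w ≤ 2ⁿ`; `S` a finite set of finite places off which every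
place is odd and good; PRINT `h33g`, `hM`, `hA`; a displayed bound `h2` at the place(s) over `2` by `C₂`; numeric constants `C_v` at
the odd `v ∈ S` justified by ONE of eight disjuncts; the two FILTERED counts of `Sel_{2^∞}(E/ℚ_n)[2]` (`ν = conj_γ − id`);
arithmetic `2^d · ∏_{v ∈ S} (2 ∈ v ? C₂ : C_v)^{(2 ∈ v ? 1 : 2^{min(n, v₂(ℓ_v² − 1) − 3)})} < 2^{w + a}`. Then
`O1.TowerGapAtTwo W` (`TowerFiltration.towerGapAtTwo_of_filtration_localKernelBounds_sharp`).
[cite: GreenbergLNM1716, §3 Lemmas 3.3–3.5 (PDF pp. 86–90) and pp. 90–93] [cite: SilvermanATAEC1994, IV.9 Table 4.1] -/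
theorem towerGapAtTwo_of_filtration_numeric_atTwo_addv4
    (h33g : lemma33_localTowerKerPrimary_eq_bot_of_good.{0})
    (hM : lemma33_localTowerKerPrimary_cyclic_of_multiplicative.{0})
    (hA : lemma33_natCard_localTowerKerPrimary_le_four_of_additive.{0})
    (htors : ¬ 2 ∣ W.torsionOrder) {n m w a d : ℕ} (hmw : m + w ≤ 2 ^ n) (C₂ : ℕ)
    (h2 : ∀ κ : ZpExtension ℚ 2, κ.IsCyclotomic → ∀ v : HeightOneSpectrum (𝓞 ℚ),
      ((2 : ℕ) : 𝓞 ℚ) ∈ v.asIdeal →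
        Finite {x : W.localTowerKerPrimary κ (v.adicCompletion ℚ) n // 2 • x = 0} ∧
          Nat.card {x : W.localTowerKerPrimary κ (v.adicCompletion ℚ) n // 2 • x = 0} ≤ C₂)
    (S : Finset (HeightOneSpectrum (𝓞 ℚ)))
    (hS : ∀ v ∉ S, ((2 : ℕ) : 𝓞 ℚ) ∉ v.asIdeal ∧ W.HasGoodReductionAt v)
    (C : HeightOneSpectrum (𝓞 ℚ) → ℕ)
    (hC : ∀ v ∈ S, ((2 : ℕ) : 𝓞 ℚ) ∉ v.asIdeal →
      4 ≤ C v ∨ (W.HasMultiplicativeReductionAt v ∧ 2 ≤ C v) ∨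
        (W.HasMultiplicativeReductionAt v ∧ ¬ 2 ∣ W.ordMinimalDiscriminant v ∧ 1 ≤ C v) ∨
        (W.HasGoodReductionAt v ∧ 1 ≤ C v) ∨
        (W.HasAdditiveReductionAt v ∧ ¬ 2 ∣ (W.kodairaSymbolAt v).componentGroupOrder ∧ 1 ≤ C v) ∨
        (W.HasAdditiveReductionAt v ∧ (∀ m, W.kodairaSymbolAt v ≠ .Istar m) ∧ 2 ≤ C v) ∨
        (W.HasAdditiveReductionAt v ∧ ¬ 2 ∣ W.ordMinimalDiscriminant v ∧ 2 ≤ C v) ∨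
        (W.HasAdditiveReductionAt v ∧
          (∀ Q : localPoints W (v.adicCompletion ℚ),
            (∀ σ : Field.absoluteGaloisGroup (v.adicCompletion ℚ), σ • Q = Q) → 2 • Q = 0 → Q = 0) ∧ 1 ≤ C v))
    (hlow : ∀ (κ : ZpExtension ℚ 2) (γ : Field.absoluteGaloisGroup ℚ), κ.IsCyclotomic →
      κ.IsTopGenerator γ →
        2 ^ a ≤ Nat.card {z : W.selmerLayer κ n // 2 • z = 0 ∧
          (⇑(W.conjH1 2 (κ.layerSubgroup n) γ -
            AddMonoidHom.id (W.subgroupH1 2 (κ.layerSubgroup n))))^[m]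
            (z : W.subgroupH1 2 (κ.layerSubgroup n)) = 0})
    (hup : ∀ (κ : ZpExtension ℚ 2) (γ : Field.absoluteGaloisGroup ℚ), κ.IsCyclotomic →
      κ.IsTopGenerator γ →
        Nat.card {z : W.selmerLayer κ n // 2 • z = 0 ∧
          (⇑(W.conjH1 2 (κ.layerSubgroup n) γ -
            AddMonoidHom.id (W.subgroupH1 2 (κ.layerSubgroup n))))^[m + w]
            (z : W.subgroupH1 2 (κ.layerSubgroup n)) = 0} ≤ 2 ^ d)
    (harith : 2 ^ d * ∏ v ∈ S, (if ((2 : ℕ) : 𝓞 ℚ) ∈ v.asIdeal then C₂ else C v) ^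
        (if ((2 : ℕ) : 𝓞 ℚ) ∈ v.asIdeal then 1
          else 2 ^ min n (padicValNat 2 (natGenerator v ^ 2 - 1) - 3)) <
      2 ^ (w + a)) : TowerGapAtTwo W := by
  refine TowerFiltration.towerGapAtTwo_of_filtration_localKernelBounds_sharp W htors hmw S
    (fun v ↦ if ((2 : ℕ) : 𝓞 ℚ) ∈ v.asIdeal then C₂ else C v) hlow hup
    (fun κ hκ v hv ↦ h33g ℚ W 2 κ hκ v (hS v hv).1 (hS v hv).2 n) (fun κ hκ v hv ↦ ?_) harith
  by_cases h2v : ((2 : ℕ) : 𝓞 ℚ) ∈ v.asIdeal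
  · rw [if_pos h2v]
    exact h2 κ hκ v h2v
  · rw [if_neg h2v]
    exact pTorsion_localTowerKer_le_of_numeric_addv4 W h33g hM hA κ hκ v h2v n (C v) (hC v hv h2v)


/-- **The FILTRATION GAP certificate indexed by rational primes, the constant at `2` a DATUM, EIGHT disjuncts.** `P` a finite set of ODD
primes containing every odd prime of the minimal discriminant, `C : ℕ → ℕ` justified per `ℓ ∈ P` by one of eight disjuncts (as in
`MultTowerAddv.towerGapAtTwo_of_layerSelmer_nat_atTwo_addv2`, proof verbatim); arithmetic
`2^d · C₂ · ∏_{ℓ ∈ P} C_ℓ^{2^{min(n, v₂(ℓ² − 1) − 3)}} < 2^{w + a}`.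
[cite: GreenbergLNM1716, §3 Lemmas 3.3–3.5 (PDF pp. 86–90) and pp. 90–93] [cite: SilvermanAEC2009, VII.1 Prop. 1.3, VII.5.1] -/
theorem towerGapAtTwo_of_filtration_nat_atTwo_addv4
    (h33g : lemma33_localTowerKerPrimary_eq_bot_of_good.{0})
    (hM : lemma33_localTowerKerPrimary_cyclic_of_multiplicative.{0})
    (hA : lemma33_natCard_localTowerKerPrimary_le_four_of_additive.{0})
    (htors : ¬ 2 ∣ W.torsionOrder) {n m w a d : ℕ} (hmw : m + w ≤ 2 ^ n) (C₂ : ℕ)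
    (h2 : ∀ κ : ZpExtension ℚ 2, κ.IsCyclotomic → ∀ v : HeightOneSpectrum (𝓞 ℚ),
      ((2 : ℕ) : 𝓞 ℚ) ∈ v.asIdeal →
        Finite {x : W.localTowerKerPrimary κ (v.adicCompletion ℚ) n // 2 • x = 0} ∧
          Nat.card {x : W.localTowerKerPrimary κ (v.adicCompletion ℚ) n // 2 • x = 0} ≤ C₂)
    (P : Finset ℕ) (hP : ∀ ℓ ∈ P, ℓ.Prime ∧ ℓ ≠ 2)
    (hΔ : ∀ ℓ : ℕ, ℓ.Prime → ℓ ≠ 2 → (ℓ : ℤ) ∣ W.minimalDiscriminantInt → ℓ ∈ P)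
    (C : ℕ → ℕ)
    (hC : ∀ (ℓ : ℕ) [Fact ℓ.Prime], ℓ ∈ P →
      4 ≤ C ℓ ∨ (W.HasMultiplicativeReductionAtPrime ℓ ∧ 2 ≤ C ℓ) ∨
        (W.HasMultiplicativeReductionAtPrime ℓ ∧ ¬ 2 ∣ padicValInt ℓ W.minimalDiscriminantInt ∧
          1 ≤ C ℓ) ∨
        (¬ (ℓ : ℤ) ∣ W.minimalDiscriminantInt ∧ 1 ≤ C ℓ) ∨
        ((∃ k : ℕ, (ℓ : ℤ) ∣ (integralModelInt W).c₄ ∧ (ℓ : ℤ) ^ k ∣ W.minimalDiscriminantInt ∧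
            ¬ (ℓ : ℤ) ^ (k + 1) ∣ W.minimalDiscriminantInt ∧
            (k = 2 ∨ k = 4 ∨ k = 5 ∨ (7 ≤ k ∧ k ≠ 9 ∧ (ℓ : ℤ) ^ k ∣ (integralModelInt W).c₄ ^ 3))) ∧ 1 ≤ C ℓ) ∨
        ((∃ k : ℕ, (ℓ : ℤ) ∣ (integralModelInt W).c₄ ∧ (ℓ : ℤ) ^ k ∣ W.minimalDiscriminantInt ∧
            ¬ (ℓ : ℤ) ^ (k + 1) ∣ W.minimalDiscriminantInt ∧ 1 ≤ k ∧ k ≠ 6 ∧ (ℓ : ℤ) ^ k ∣ (integralModelInt W).c₄ ^ 3) ∧ 2 ≤ C ℓ) ∨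
        ((∃ k : ℕ, (ℓ : ℤ) ∣ (integralModelInt W).c₄ ∧ (ℓ : ℤ) ^ k ∣ W.minimalDiscriminantInt ∧
            ¬ (ℓ : ℤ) ^ (k + 1) ∣ W.minimalDiscriminantInt ∧ ¬ 2 ∣ k) ∧ 2 ≤ C ℓ) ∨
        (((ℓ : ℤ) ∣ (integralModelInt W).c₄ ∧ (ℓ : ℤ) ∣ W.minimalDiscriminantInt ∧
            ∃ k : ℕ, ∀ x : ZMod (ℓ ^ k), 4 * x ^ 3 + ((integralModelInt W).b₂ : ZMod (ℓ ^ k)) * x ^ 2 +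
              2 * ((integralModelInt W).b₄ : ZMod (ℓ ^ k)) * x + ((integralModelInt W).b₆ : ZMod (ℓ ^ k)) ≠ 0) ∧
          1 ≤ C ℓ))
    (hlow : ∀ (κ : ZpExtension ℚ 2) (γ : Field.absoluteGaloisGroup ℚ), κ.IsCyclotomic →
      κ.IsTopGenerator γ →
        2 ^ a ≤ Nat.card {z : W.selmerLayer κ n // 2 • z = 0 ∧
          (⇑(W.conjH1 2 (κ.layerSubgroup n) γ -
            AddMonoidHom.id (W.subgroupH1 2 (κ.layerSubgroup n))))^[m]
            (z : W.subgroupH1 2 (κ.layerSubgroup n)) = 0})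
    (hup : ∀ (κ : ZpExtension ℚ 2) (γ : Field.absoluteGaloisGroup ℚ), κ.IsCyclotomic →
      κ.IsTopGenerator γ →
        Nat.card {z : W.selmerLayer κ n // 2 • z = 0 ∧
          (⇑(W.conjH1 2 (κ.layerSubgroup n) γ -
            AddMonoidHom.id (W.subgroupH1 2 (κ.layerSubgroup n))))^[m + w]
            (z : W.subgroupH1 2 (κ.layerSubgroup n)) = 0} ≤ 2 ^ d)
    (harith : 2 ^ d * C₂ * ∏ ℓ ∈ P, C ℓ ^ 2 ^ min n (padicValNat 2 (ℓ ^ 2 - 1) - 3) <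
      2 ^ (w + a)) : TowerGapAtTwo W := by
  -- the places (exactly as in tower-1 part 8 / GEN 4 / GEN 8)
  let pl : ℕ → HeightOneSpectrum (𝓞 ℚ) := fun ℓ ↦
    if h : ℓ.Prime then (primesEquiv (R := 𝓞 ℚ)).symm ⟨ℓ, h⟩
      else (primesEquiv (R := 𝓞 ℚ)).symm ⟨2, Nat.prime_two⟩
  have hpl : ∀ {ℓ : ℕ}, ℓ.Prime → natGenerator (pl ℓ) = ℓ := fun {ℓ} h ↦ by
    simp only [pl, dif_pos h]
    exact congrArg Subtype.val ((primesEquiv (R := 𝓞 ℚ)).apply_symm_apply ⟨ℓ, h⟩)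
  have hpl_inj : Set.InjOn pl P := by
    intro ℓ hℓ ℓ' hℓ' h
    have := congrArg natGenerator h
    rwa [hpl (hP ℓ hℓ).1, hpl (hP ℓ' hℓ').1] at this
  let v₂ : HeightOneSpectrum (𝓞 ℚ) := pl 2
  have hv₂ : natGenerator v₂ = 2 := hpl Nat.prime_two
  have h2v₂ : ((2 : ℕ) : 𝓞 ℚ) ∈ v₂.asIdeal := (natCast_prime_mem_asIdeal_iff v₂ Nat.prime_two).mpr hv₂
  have hv₂_notMem : v₂ ∉ P.image pl := by
    intro h
    obtain ⟨ℓ, hℓ, hℓeq⟩ := Finset.mem_image.mp h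
    have := congrArg natGenerator hℓeq
    rw [hpl (hP ℓ hℓ).1, hv₂] at this
    exact (hP ℓ hℓ).2 this
  -- odd places in the image
  have hodd : ∀ {ℓ : ℕ}, ℓ ∈ P → ((2 : ℕ) : 𝓞 ℚ) ∉ (pl ℓ).asIdeal := fun {ℓ} hℓ h ↦ by
    rw [natCast_prime_mem_asIdeal_iff _ Nat.prime_two, hpl (hP ℓ hℓ).1] at h
    exact (hP ℓ hℓ).2 h
  let S : Finset (HeightOneSpectrum (𝓞 ℚ)) := insert v₂ (P.image pl)
  let Cv : HeightOneSpectrum (𝓞 ℚ) → ℕ := fun v ↦ C (natGenerator v)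
  refine towerGapAtTwo_of_filtration_numeric_atTwo_addv4 W h33g hM hA htors hmw C₂ h2 S ?_ Cv ?_ hlow hup ?_
  · -- `hS`: off `S` every place is odd and good
    intro v hv
    have hgen := prime_natGenerator v
    haveI : Fact (natGenerator v).Prime := ⟨hgen⟩
    have hvpl : pl (natGenerator v) = v := by
      simp only [pl, dif_pos hgen]
      exact (primesEquiv (R := 𝓞 ℚ)).symm_apply_apply v
    have hne2 : natGenerator v ≠ 2 := by
      intro h
      apply hv
      rw [Finset.mem_insert]
      left
      rw [← hvpl]
      simp only [v₂, h]
    have hnotP : natGenerator v ∉ P := by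
      intro h
      exact hv (Finset.mem_insert_of_mem (Finset.mem_image.mpr ⟨_, h, hvpl⟩))
    refine ⟨fun h ↦ hne2 ((natCast_prime_mem_asIdeal_iff v Nat.prime_two).mp h), ?_⟩
    have hndvd : ¬ ((natGenerator v : ℕ) : ℤ) ∣ W.minimalDiscriminantInt :=
      fun h ↦ hnotP (hΔ _ hgen hne2 h)
    exact (hasGoodReductionAtPrime_iff_hasGoodReductionAt_ringOfIntegers (v := v) W).mp
      (hasGoodReductionAtPrime_of_not_dvd W (natGenerator v) hndvd)
  · -- `hC`: the numeric local constants at the odd places of `S`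
    intro v hv h2
    rcases Finset.mem_insert.mp hv with rfl | hv'
    · exact absurd h2v₂ h2
    obtain ⟨ℓ, hℓP, rfl⟩ := Finset.mem_image.mp hv'
    have hℓ := (hP ℓ hℓP).1
    haveI : Fact ℓ.Prime := ⟨hℓ⟩
    have hgen : natGenerator (pl ℓ) = ℓ := hpl hℓ
    haveI : Fact (Nat.Prime ((primesEquiv (pl ℓ) : Nat.Primes) : ℕ)) := ⟨(primesEquiv (pl ℓ)).2⟩
    have hpe : ((primesEquiv (pl ℓ) : Nat.Primes) : ℕ) = ℓ := hgen
    have hCv : Cv (pl ℓ) = C ℓ := by simp only [Cv, hgen]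
    rw [hCv]
    rcases hC ℓ hℓP with h4 | ⟨hm, h2C⟩ | ⟨hm, hord, h1⟩ | ⟨hg, h1⟩ | ⟨⟨k, hc₄, hk, hk', hcases⟩, h1⟩ |
        ⟨⟨k, hc₄, hk, hk', hk1, hk6, hj⟩, h2C⟩ | ⟨⟨k, hc₄, hk, hk', hko⟩, h2C⟩ | ⟨⟨hc₄, hdΔ, k, hcert⟩, h1⟩
    · exact Or.inl h4
    · refine Or.inr (Or.inl ⟨?_, h2C⟩)
      exact (hasMultiplicativeReductionAtPrime_iff_hasMultiplicativeReductionAt_ringOfIntegers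
        (W := W) (pl ℓ)).mp ((hasMultiplicativeReductionAtPrime_congr W hpe).mpr hm)
    · refine Or.inr (Or.inr (Or.inl ⟨?_, ?_, h1⟩))
      · exact (hasMultiplicativeReductionAtPrime_iff_hasMultiplicativeReductionAt_ringOfIntegers
          (W := W) (pl ℓ)).mp ((hasMultiplicativeReductionAtPrime_congr W hpe).mpr hm)
      · rwa [LocalTorsionMult.ordMinimalDiscriminant_eq_padicValInt W (pl ℓ) hpe]
    · refine Or.inr (Or.inr (Or.inr (Or.inl ⟨?_, h1⟩)))
      exact (hasGoodReductionAtPrime_iff_hasGoodReductionAt_ringOfIntegers (v := pl ℓ) W).mp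
        ((hasGoodReductionAtPrime_congr W hpe).mpr (hasGoodReductionAtPrime_of_not_dvd W ℓ hg))
    · refine Or.inr (Or.inr (Or.inr (Or.inr (Or.inl ⟨?_, ?_, h1⟩))))
      · exact (hasAdditiveReductionAt_and_not_two_dvd_componentGroupOrder_of_cert W (pl ℓ) hpe (hP ℓ hℓP).2
          hc₄ hk hk' hcases).1
      · exact (hasAdditiveReductionAt_and_not_two_dvd_componentGroupOrder_of_cert W (pl ℓ) hpe (hP ℓ hℓP).2
          hc₄ hk hk' hcases).2
    · refine Or.inr (Or.inr (Or.inr (Or.inr (Or.inr (Or.inl ⟨?_, ?_, h2C⟩)))))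
      · exact (hasAdditiveReductionAt_and_ne_Istar_of_cert W (pl ℓ) hpe (hP ℓ hℓP).2 hc₄ hk hk' hk1 hk6 hj).1
      · exact (hasAdditiveReductionAt_and_ne_Istar_of_cert W (pl ℓ) hpe (hP ℓ hℓP).2 hc₄ hk hk' hk1 hk6 hj).2
    · refine Or.inr (Or.inr (Or.inr (Or.inr (Or.inr (Or.inr (Or.inl ⟨?_, ?_, h2C⟩))))))
      · exact (hasAdditiveReductionAt_and_odd_ord_of_cert W (pl ℓ) hpe hc₄ hk hk' hko).1
      · rw [LocalTorsionMult.ordMinimalDiscriminant_eq_padicValInt W (pl ℓ) hpe, padicValInt_eq_of_dvd_of_not_dvd hk hk']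
        exact hko
    · refine Or.inr (Or.inr (Or.inr (Or.inr (Or.inr (Or.inr (Or.inr ⟨?_, ?_, h1⟩))))))
      · exact W.hasAdditiveReductionAt_of_dvd_of_dvd (pl ℓ) (by rw [hpe]; exact hdΔ) (by rw [hpe]; exact hc₄)
      · exact TowerAddvZ.noTwoTorsion_of_cubic_cert W (pl ℓ) hpe (hP ℓ hℓP).2 (TowerAddvZ.b_eq_integralModelInt W) hcert
  · -- the arithmetic, re-indexed by primes
    have hprod : ∏ v ∈ S, (if ((2 : ℕ) : 𝓞 ℚ) ∈ v.asIdeal then C₂ else Cv v) ^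
        (if ((2 : ℕ) : 𝓞 ℚ) ∈ v.asIdeal then 1
          else 2 ^ min n (padicValNat 2 (natGenerator v ^ 2 - 1) - 3)) =
        C₂ * ∏ ℓ ∈ P, C ℓ ^ 2 ^ min n (padicValNat 2 (ℓ ^ 2 - 1) - 3) := by
      rw [Finset.prod_insert hv₂_notMem, if_pos h2v₂, if_pos h2v₂, pow_one,
        Finset.prod_image hpl_inj]
      congr 1
      refine Finset.prod_congr rfl fun ℓ hℓ ↦ ?_
      rw [if_neg (hodd hℓ), if_neg (hodd hℓ)]
      simp only [Cv, hpl (hP ℓ hℓ).1]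
    rw [hprod, ← mul_assoc]
    exact harith



end Gap

end Summit.BirchSwinnertonDyer.BirchSwinnertonDyer.Theorems.MultTowerFilt

end
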